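import Literature.MathematicalPhysics.QuantumLattice.CorrelationLightConeLattice
import Literature.MathematicalPhysics.QuantumLattice.SpectralSmoothingProofs
import HarnessLib

/-!
# Quasi-locality of weighted time averages and the telescoping decomposition

Eleventh file of the formalisation of the Michalakis–Zwolak stability theorem (hubbard.S19): the
localisation engine behind MZ13 Lemma 1 (iv) and Lemma 2 (the decompositions
`𝓕(O_u(r)) = Σ_{r'} 𝓕(r'; O_u(r))`, `𝒮(O_u(r)) = Σ_{r'} 𝒮(r'; O_u(r))` into pieces supported on
growing balls with rapidly decaying norms), in the finite-twirl formulation of the tree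
(`twirl S M` = normalised partial trace over `S`, `CorrelationLightCone.lean`):

* the twirl is linear (`twirl_add`, `twirl_smul`, `twirl_sub`), is the identity over `∅`
  (`twirl_empty`), and commutes with Bochner integrals (`twirl_integral`);
* **quasi-locality of `∫ w(t) • τ_t(O) dt`** (`norm_integral_smul_heisenbergEvolution_sub_twirl_le`):
  commutator bounds `‖[τ_t(O), U]‖ ≤ g(t)` against unitaries supported off a region `T` (as
  supplied by the Lieb–Robinson bound, `LiebRobinsonBoundProofs`) give
  `‖F − 𝔼_{Tᶜ}(F)‖ ≤ ∫ |w(t)| min(g(t), 2‖O‖) dt` for `F = ∫ w • τ_t O`;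
* **telescoping decomposition** (`eq_twirl_add_sum_range_sub`): along an increasing chain of
  regions ending in `Λ`, `F = 𝔼_{(S 0)ᶜ}F + Σ_ℓ (𝔼_{(S(ℓ+1))ᶜ}F − 𝔼_{(S ℓ)ᶜ}F)` with the pieces
  supported on `S (ℓ+1)` (`isSupportedOn_twirl_compl_sub`) and bounded by the two localisation
  errors (`norm_twirl_sub_twirl_le`).

Sources: Bachmann–Michalakis–Nachtergaele–Sims, CMP **309** (2012) 835 = arXiv:1102.0842, §4
(p. 13 of the arXiv text: the decomposition `∫ τ_t(A) W_γ(t) dt = Σ_n Δ^n_Λ(A,s)` with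
`Δ^n = Π_{X_n}(…) − Π_{X_{n−1}}(…)` and the estimate split at `|t| = T`); Michalakis–Zwolak,
arXiv:1109.1588 §5.1, proof of Lemma 1 (iv) ("the usual technique of bounding the integral
`∫ f(t) g(t) dt ≤ ‖g‖ ∫_{−T}^{T} |f| + ‖f‖ ∫_{|t|≥T} |g|`"). No definitions, no named facts
(theorems only).
-/

noncomputable section

open Matrix Complex NormedSpace MeasureTheory Finset
open scoped Matrix.Norms.L2Operator

namespace Literature.MathematicalPhysics.QuantumLattice

variable {Λ : Type*} [Fintype Λ] [DecidableEq Λ] {q : ℕ}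

/-! ### The twirl is linear, contractive, and commutes with Bochner integrals -/

/-- The twirl is additive. [folklore] -/
theorem twirl_add (S : Finset Λ) (M N : Op Λ q) : twirl S (M + N) = twirl S M + twirl S N := by
  simp only [twirl, Matrix.mul_add, Matrix.add_mul, sum_add_distrib, smul_add]

/-- The twirl is homogeneous. [folklore] -/
theorem twirl_smul (S : Finset Λ) (c : ℂ) (M : Op Λ q) : twirl S (c • M) = c • twirl S M := by
  simp only [twirl, Matrix.mul_smul, Matrix.smul_mul, ← smul_sum, smul_comm c]

/-- The twirl of a difference. [folklore] -/
theorem twirl_sub (S : Finset Λ) (M N : Op Λ q) : twirl S (M - N) = twirl S M - twirl S N := by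
  rw [sub_eq_add_neg, twirl_add, ← neg_one_smul ℂ N, twirl_smul, neg_one_smul, sub_eq_add_neg]

/-- The twirl over the empty region is the identity (the only unitaries supported on `∅` are
phases). [folklore] -/
theorem twirl_empty (M : Op Λ q) : twirl (∅ : Finset Λ) M = M := by
  have h : ‖M - twirl (∅ : Finset Λ) M‖ ≤ 0 := by
    refine norm_sub_twirl_le ∅ M fun U hU _ => ?_
    obtain ⟨a, rfl⟩ := exists_eq_smul_one_of_isSupportedOn_empty hU
    rw [Matrix.mul_smul, Matrix.mul_one, Matrix.smul_mul, Matrix.one_mul, sub_self, norm_zero]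
  have h0 : M - twirl (∅ : Finset Λ) M = 0 := norm_le_zero_iff.mp h
  exact (sub_eq_zero.mp h0).symm

/-- **The twirl commutes with the Bochner integral** (it is a continuous linear map).
[folklore] -/
theorem twirl_integral (S : Finset Λ) {f : ℝ → Op Λ q} (hf : Integrable f) :
    twirl S (∫ t : ℝ, f t) = ∫ t : ℝ, twirl S (f t) := by
  let L : Op Λ q →ₗ[ℂ] Op Λ q :=
    { toFun := fun N => twirl S N, map_add' := twirl_add S, map_smul' := fun c N => twirl_smul S c N }
  have h := ContinuousLinearMap.integral_comp_comm (LinearMap.toContinuousLinearMap L) hf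
  exact h.symm

/-! ### Approximation of the evolved observable by its twirls -/

/-- For Hermitian `H`, commutator bounds against unitaries supported off a region `T` localise the
evolved observable: `‖τ_t(O) − 𝔼_{Tᶜ}(τ_t(O))‖ ≤ min(ε, 2‖O‖)`. [folklore] -/
theorem norm_heisenbergEvolution_sub_twirl_le {H : Op Λ q} (hH : H.IsHermitian) (O : Op Λ q)
    (t : ℝ) (T : Finset Λ) {ε : ℝ}
    (h : ∀ U : Op Λ q, IsSupportedOn U Tᶜ → U ∈ unitary (Op Λ q) →
      ‖heisenbergEvolution H t O * U - U * heisenbergEvolution H t O‖ ≤ ε) :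
    ‖heisenbergEvolution H t O - twirl Tᶜ (heisenbergEvolution H t O)‖ ≤ min ε (2 * ‖O‖) := by
  refine le_min (norm_sub_twirl_le _ _ h) ?_
  calc ‖heisenbergEvolution H t O - twirl Tᶜ (heisenbergEvolution H t O)‖
      ≤ ‖heisenbergEvolution H t O‖ + ‖twirl Tᶜ (heisenbergEvolution H t O)‖ := norm_sub_le _ _
    _ ≤ ‖heisenbergEvolution H t O‖ + ‖heisenbergEvolution H t O‖ :=
        add_le_add le_rfl (norm_twirl_le _ _)
    _ = 2 * ‖O‖ := by rw [norm_heisenbergEvolution_holds hH]; ring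

/-- **Quasi-locality of a weighted time average.** Let `F = ∫ w(t) • τ_t(O) dt` for an integrable
weight `w` and Hermitian `H`, and suppose that for a region `T` the evolved observable satisfies
the commutator bound `‖[τ_t(O), U]‖ ≤ g(t)` against unitaries `U` supported off `T`, with `g`
continuous. Then `F` is within `∫ |w(t)| min(g(t), 2‖O‖) dt` of its localisation
`𝔼_{Tᶜ}(F) ∈ 𝔄_T`. Bachmann–Michalakis–Nachtergaele–Sims, arXiv:1102.0842, §4 (p. 13: the
estimate of `‖∫ (Π_{X_n} − id)(τ_t(A)) W_γ(t) dt‖` split at `|t| = T`); Michalakis–Zwolak §5.1,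
proof of Lemma 1 (iv) ("the usual technique of bounding the integral …"). [folklore] -/
theorem norm_integral_smul_heisenbergEvolution_sub_twirl_le {H : Op Λ q} (hH : H.IsHermitian)
    (O : Op Λ q) {w : ℝ → ℂ} (hw : Integrable w) (T : Finset Λ) {g : ℝ → ℝ} (hg : Continuous g)
    (h : ∀ t : ℝ, ∀ U : Op Λ q, IsSupportedOn U Tᶜ → U ∈ unitary (Op Λ q) →
      ‖heisenbergEvolution H t O * U - U * heisenbergEvolution H t O‖ ≤ g t) :
    ‖(∫ t : ℝ, w t • heisenbergEvolution H t O) -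
        twirl Tᶜ (∫ t : ℝ, w t • heisenbergEvolution H t O)‖ ≤
      ∫ t : ℝ, ‖w t‖ * min (g t) (2 * ‖O‖) := by
  have hint := integrable_smul_heisenbergEvolution hH hw O
  rw [twirl_integral _ hint, ← integral_sub hint]
  swap
  · -- integrability of the twirled integrand (a CLM image)
    let L : Op Λ q →ₗ[ℂ] Op Λ q :=
      { toFun := fun N => twirl Tᶜ N, map_add' := twirl_add Tᶜ,
        map_smul' := fun c N => twirl_smul Tᶜ c N }
    exact (LinearMap.toContinuousLinearMap L).integrable_comp hint
  -- pointwise bound, then integrate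
  have hbound : ∀ t, ‖w t • heisenbergEvolution H t O - twirl Tᶜ (w t • heisenbergEvolution H t O)‖ ≤
      ‖w t‖ * min (g t) (2 * ‖O‖) := fun t => by
    rw [twirl_smul, ← smul_sub, norm_smul]
    exact mul_le_mul_of_nonneg_left (norm_heisenbergEvolution_sub_twirl_le hH O t T (h t))
      (norm_nonneg _)
  have hgi : Integrable fun t : ℝ => ‖w t‖ * min (g t) (2 * ‖O‖) := by
    refine (hw.norm.mul_const (2 * ‖O‖)).mono' ?_ (Filter.Eventually.of_forall fun t => ?_)
    · exact (hw.aestronglyMeasurable.norm.mul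
        ((hg.min continuous_const).aestronglyMeasurable))
    · rw [Real.norm_eq_abs, abs_mul, abs_norm]
      refine mul_le_mul_of_nonneg_left ?_ (norm_nonneg _)
      rw [abs_le]
      constructor
      · have : 0 ≤ min (g t) (2 * ‖O‖) := by
          have h2 := norm_heisenbergEvolution_sub_twirl_le hH O t T (h t)
          exact (norm_nonneg _).trans h2
        linarith [norm_nonneg O]
      · exact min_le_right _ _
  calc ‖∫ t : ℝ, (w t • heisenbergEvolution H t O - twirl Tᶜ (w t • heisenbergEvolution H t O))‖
      ≤ ∫ t : ℝ, ‖w t • heisenbergEvolution H t O - twirl Tᶜ (w t • heisenbergEvolution H t O)‖ :=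
        norm_integral_le_integral_norm _
    _ ≤ ∫ t : ℝ, ‖w t‖ * min (g t) (2 * ‖O‖) :=
        integral_mono_of_nonneg (Filter.Eventually.of_forall fun t => norm_nonneg _) hgi
          (Filter.Eventually.of_forall hbound)

/-! ### The telescoping (`Δ`-) decomposition into strictly local pieces -/

/-- The localisation `𝔼_{Tᶜ}(F)` is supported on `T`. [folklore] -/
theorem isSupportedOn_twirl_compl (T : Finset Λ) (F : Op Λ q) : IsSupportedOn (twirl Tᶜ F) T := by
  simpa using isSupportedOn_twirl Tᶜ F

/-- Differences of nested localisations are supported on the larger region. [folklore] -/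
theorem isSupportedOn_twirl_compl_sub {T T' : Finset Λ} (h : T ⊆ T') (F : Op Λ q) :
    IsSupportedOn (twirl T'ᶜ F - twirl Tᶜ F) T' := by
  have h1 := isSupportedOn_twirl_compl T' F
  have h2 : IsSupportedOn (twirl Tᶜ F) T' := IsSupportedOn.mono_holds (isSupportedOn_twirl_compl T F) h
  have h3 := h1.add (h2.smul (-1))
  simpa [sub_eq_add_neg] using h3

/-- Norm of a difference of localisations through the two approximation errors. [folklore] -/
theorem norm_twirl_sub_twirl_le (T T' : Finset Λ) (F : Op Λ q) :
    ‖twirl T'ᶜ F - twirl Tᶜ F‖ ≤ ‖F - twirl T'ᶜ F‖ + ‖F - twirl Tᶜ F‖ := by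
  have : twirl T'ᶜ F - twirl Tᶜ F = (F - twirl Tᶜ F) - (F - twirl T'ᶜ F) := by abel
  rw [this]
  exact (norm_sub_le _ _).trans (by rw [add_comm])

/-- **Telescoping decomposition** (BMNS `Δ`-decomposition): for an increasing chain of regions
`S 0 ⊆ S 1 ⊆ … ⊆ S m = Λ`, every operator is the sum of its coarsest localisation and the
successive differences, `F = 𝔼_{(S 0)ᶜ}(F) + Σ_{ℓ<m} (𝔼_{(S (ℓ+1))ᶜ}(F) − 𝔼_{(S ℓ)ᶜ}(F))`, each
difference being supported on `S (ℓ+1)` (`isSupportedOn_twirl_compl_sub`) with norm controlled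
by the two localisation errors (`norm_twirl_sub_twirl_le`,
`norm_integral_smul_heisenbergEvolution_sub_twirl_le`). Bachmann–Michalakis–Nachtergaele–Sims,
arXiv:1102.0842 p. 13 ("`∫ τ_t^{H_Λ(s)}(A) W_γ(t) dt = Σ_{n≥0} Δ_Λ^n(A,s)`"); Michalakis–Zwolak
§5.1 Lemma 1 (iv) (the decomposition `𝓕(O_u(r)) = Σ_{r'} 𝓕(r'; O_u(r))`). [folklore] -/
theorem eq_twirl_add_sum_range_sub (S : ℕ → Finset Λ) {m : ℕ} (hm : S m = univ) (F : Op Λ q) :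
    F = twirl (S 0)ᶜ F + ∑ ℓ ∈ range m, (twirl (S (ℓ + 1))ᶜ F - twirl (S ℓ)ᶜ F) := by
  rw [Finset.sum_range_sub (fun ℓ => twirl (S ℓ)ᶜ F) m, hm, compl_univ, twirl_empty]
  abel

end Literature.MathematicalPhysics.QuantumLattice
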